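import Summits.CriticalPhenomena.PercolationContinuityZ3.Theorems.PercNearOneGluingNoHeavyQuantClusterSizeEvents
import HarnessLib

/-!
# The Taylor germ of `θ` at `p = 1`, part I: closed edges around a finite open cluster
# (quant lane, METHOD = differential inequalities for `θ`, seat p4 gen 15)

builds on p205010 (kernel theorem, internal audit signed; external expert review pending) — NOT used in this file.

Combinatorial input for `θ(p) = 1 − (1−p)^{2d} + O((1−p)^{2d+1})` at the level of the one-sided Taylor coefficients at
`p = 1` (next file).  For a finite set `S` of lattice edges (the open edges) with the open cluster `C = C(0)` of the
origin finite with `n` vertices, and `K_n` = the edges touching `Λ_n` (so `C ⊆ Λ_n`, gen 9):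

* §1 unit edges `s(x, x + e_i)` remember their direction and base point (`ThetaGerm.eq_of_edge_eq`); an edge with
  exactly one endpoint in `C` lies in `K_n ∖ S` (`mem_sdiff_of_boundary`).
* §2 **`ThetaGerm.card_sdiff_ge (hd : 2 ≤ d) (hn : 2 ≤ n) : 2d + 1 ≤ #(K_n ∖ S)`** — the `2d` extremal edges (top and
  bottom of `C` in every coordinate direction) and one more top edge on a second line (two points of `C` differ in a
  coordinate `i₀`; lines in a direction `j ≠ i₀` through them are distinct).  Elementary discrete isoperimetry
  (`|∂_E C| ≥ 2d + 2` for `|C| ≥ 2`; we only need `2d + 1`).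
* §3 `n = 1`: `|C| = 1` iff no edge at the origin is open (`ThetaGerm.ncard_eq_one_iff`); the `2d` origin edges
  (`card_originEdges`) touch `Λ_1`.  §4 `n = 0` is impossible (`0 ∈ C`).

HONEST STATUS: folklore lattice combinatorics (the first two perimeter polynomials); no literature claim.

## References
* G. Grimmett, *Percolation*, 2nd ed. (1999): §8.7 (8.93)–(8.94) (the polynomials `P_p(|C| = n)`), §1.5 p. 23
  [GrimmettPercolation1999].
-/

noncomputable section

namespace Summit.CriticalPhenomena.PercolationContinuityZ3.Theorems

open Set Literature.Probability.Percolation Literature.Probability.LatticeModels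
open scoped Classical

namespace ThetaGerm

variable {d : ℕ}

/-! ### §1. Unit edges and boundary edges of the cluster -/

/-- `x + e_i ≠ x`. -/
theorem add_single_ne (x : Site d) (i : Fin d) : x + Pi.single i 1 ≠ x := by
  intro h
  have := congr_fun h i
  simp at this

/-- `(x + e_i) i = x i + 1`. -/
theorem add_single_apply_self (x : Site d) (i : Fin d) : (x + Pi.single i (1 : ℤ) : Site d) i = x i + 1 := by
  rw [Pi.add_apply, Pi.single_eq_same]

/-- `(x + e_i) m = x m` for `m ≠ i`. -/
theorem add_single_apply_ne (x : Site d) {i m : Fin d} (h : m ≠ i) : (x + Pi.single i (1 : ℤ) : Site d) m = x m := by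
  rw [Pi.add_apply, Pi.single_apply, if_neg h, add_zero]

/-- `(x - e_i) i = x i - 1`. -/
theorem sub_single_apply_self (x : Site d) (i : Fin d) : (x - Pi.single i (1 : ℤ) : Site d) i = x i - 1 := by
  rw [Pi.sub_apply, Pi.single_eq_same]

/-- **A unit edge `s(x, x + e_i)` determines `i` and `x`.** -/
theorem eq_of_edge_eq {x y : Site d} {i j : Fin d}
    (h : s(x, x + Pi.single i (1 : ℤ)) = s(y, y + Pi.single j (1 : ℤ))) : i = j ∧ x = y := by
  rcases Sym2.eq_iff.1 h with ⟨h1, h2⟩ | ⟨h1, h2⟩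
  · subst h1
    have h3 : (Pi.single i (1 : ℤ) : Site d) = Pi.single j 1 := add_left_cancel h2
    have h4 : (Pi.single i (1 : ℤ) : Site d) i = (Pi.single j (1 : ℤ) : Site d) i := by rw [h3]
    rw [Pi.single_eq_same, Pi.single_apply] at h4
    by_cases hij : i = j
    · exact ⟨hij, rfl⟩
    · rw [if_neg hij] at h4
      exact absurd h4 one_ne_zero
  · exfalso
    have h3 : (Pi.single j (1 : ℤ) : Site d) + Pi.single i 1 = 0 := by
      have : y + (Pi.single j (1 : ℤ) + Pi.single i 1) = y + 0 := by rw [add_zero, ← add_assoc, ← h1, h2]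
      exact add_left_cancel this
    have h4 := congr_fun h3 i
    simp only [Pi.add_apply, Pi.single_eq_same, Pi.zero_apply, Pi.single_apply] at h4
    split_ifs at h4 <;> omega

/-- `s(x, x + e_i)` is an edge of `ℤ^d`. -/
theorem edge_mem_edgeSet (x : Site d) (i : Fin d) : s(x, x + Pi.single i (1 : ℤ)) ∈ (zdGraph d).edgeSet :=
  (SimpleGraph.mem_edgeSet _).2 ((zdGraph_adj_iff _ _).2 ⟨i, Or.inl rfl⟩)

/-- An open edge out of the cluster leads into the cluster. -/
theorem mem_openCluster_of_mem {ω : BondConfig (Site d)} {x y : Site d} (hx : x ∈ openCluster ω 0)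
    (he : s(x, y) ∈ ω) (hne : x ≠ y) : y ∈ openCluster ω 0 :=
  SimpleGraph.Reachable.trans hx (SimpleGraph.Adj.reachable ((openGraph_adj ω x y).2 ⟨he, hne⟩))

/-- **Boundary edges are closed edges of `K_n`**: if exactly one endpoint of the unit edge `s(x, x + e_i)` lies in the
(finite, `n`-vertex) open cluster of the origin of the configuration `↑S ∩ E`, then the edge touches `Λ_n` and is
not in `S`. -/
theorem mem_sdiff_of_boundary {n : ℕ} {S : Finset (Sym2 (Site d))}
    (hS : (openCluster ((↑S : Set (Sym2 (Site d))) ∩ (zdGraph d).edgeSet) 0).Finite)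
    (hSn : (openCluster ((↑S : Set (Sym2 (Site d))) ∩ (zdGraph d).edgeSet) 0).ncard = n)
    {x : Site d} {i : Fin d}
    (hx : x ∈ openCluster ((↑S : Set (Sym2 (Site d))) ∩ (zdGraph d).edgeSet) 0 ↔
      x + Pi.single i 1 ∉ openCluster ((↑S : Set (Sym2 (Site d))) ∩ (zdGraph d).edgeSet) 0) :
    s(x, x + Pi.single i (1 : ℤ)) ∈ edgesTouching (zdGraph d) (box d n) \ S := by
  have hbox := ChiF.openCluster_subset_box_of_ncard (Set.inter_subset_right) hS hSn
  have hE := edge_mem_edgeSet x i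
  rw [Finset.mem_sdiff, mem_edgesTouching_iff]
  by_cases hxC : x ∈ openCluster ((↑S : Set (Sym2 (Site d))) ∩ (zdGraph d).edgeSet) 0
  · refine ⟨⟨hE, x, hbox hxC, Sym2.mem_mk_left _ _⟩, fun hS' => ?_⟩
    exact (hx.1 hxC) (mem_openCluster_of_mem hxC ⟨Finset.mem_coe.2 hS', hE⟩ (add_single_ne x i).symm)
  · have h2 : x + Pi.single i 1 ∈ openCluster ((↑S : Set (Sym2 (Site d))) ∩ (zdGraph d).edgeSet) 0 := by
      by_contra h; exact hxC (hx.2 h)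
    refine ⟨⟨hE, _, hbox h2, Sym2.mem_mk_right _ _⟩, fun hS' => hxC ?_⟩
    refine mem_openCluster_of_mem h2 ?_ (add_single_ne x i)
    rw [Sym2.eq_swap]; exact ⟨Finset.mem_coe.2 hS', hE⟩

/-! ### §2. At least `2d + 1` closed edges around a cluster with two or more vertices -/

/-- **`2d + 1 ≤ #(K_n ∖ S)`** when the open cluster of the origin (configuration `↑S ∩ E`) is finite with `n ≥ 2`
vertices, `d ≥ 2`. -/
theorem card_sdiff_ge (hd : 2 ≤ d) {n : ℕ} (hn : 2 ≤ n) {S : Finset (Sym2 (Site d))}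
    (hS : (openCluster ((↑S : Set (Sym2 (Site d))) ∩ (zdGraph d).edgeSet) 0).Finite)
    (hSn : (openCluster ((↑S : Set (Sym2 (Site d))) ∩ (zdGraph d).edgeSet) 0).ncard = n) :
    2 * d + 1 ≤ (edgesTouching (zdGraph d) (box d n) \ S).card := by
  set C : Set (Site d) := openCluster ((↑S : Set (Sym2 (Site d))) ∩ (zdGraph d).edgeSet) 0 with hC
  set Cf : Finset (Site d) := hS.toFinset with hCf
  have hmemCf : ∀ x, x ∈ Cf ↔ x ∈ C := fun x => Set.Finite.mem_toFinset hS
  have hne : Cf.Nonempty := ⟨0, (hmemCf 0).2 (mem_openCluster_self _ 0)⟩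
  -- tops and bottoms in every direction
  have htop : ∀ i : Fin d, ∃ x ∈ C, ∀ z ∈ C, z i ≤ x i := fun i => by
    obtain ⟨x, hx, hmax⟩ := Finset.exists_max_image Cf (fun x => x i) hne
    exact ⟨x, (hmemCf x).1 hx, fun z hz => hmax z ((hmemCf z).2 hz)⟩
  choose xt hxtC hxtmax using htop
  have hbot : ∀ i : Fin d, ∃ x ∈ C, ∀ z ∈ C, x i ≤ z i := fun i => by
    obtain ⟨x, hx, hmin⟩ := Finset.exists_min_image Cf (fun x => x i) hne
    exact ⟨x, (hmemCf x).1 hx, fun z hz => hmin z ((hmemCf z).2 hz)⟩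
  choose xb hxbC hxbmin using hbot
  have hxt_out : ∀ i, xt i + Pi.single i 1 ∉ C := fun i h => by
    have := hxtmax i _ h
    rw [add_single_apply_self] at this
    linarith
  have hxb_out : ∀ i, xb i - Pi.single i 1 ∉ C := fun i h => by
    have := hxbmin i _ h
    rw [sub_single_apply_self] at this
    linarith
  -- two distinct points, a coordinate where they differ, a second direction
  have h2 : 1 < C.ncard := by rw [hSn]; omega
  obtain ⟨u, hu, v, hv, huv⟩ := (Set.one_lt_ncard hS).1 h2
  obtain ⟨i₀, hi₀⟩ := Function.ne_iff.1 huv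
  have hcard : 1 < Fintype.card (Fin d) := by rw [Fintype.card_fin]; omega
  obtain ⟨j, hj⟩ := Fintype.exists_ne_of_one_lt_card hcard i₀
  -- a point `w ∈ C` off the `j`-line of the global top `xt j`
  obtain ⟨w, hwC, hw⟩ : ∃ w ∈ C, w i₀ ≠ xt j i₀ := by
    by_cases huq : u i₀ = xt j i₀
    · exact ⟨v, hv, fun h => hi₀ (huq.trans h.symm)⟩
    · exact ⟨u, hu, huq⟩
  -- the top of `C` on the `j`-line through `w`
  set Lw : Finset (Site d) := Cf.filter (fun z => ∀ m, m ≠ j → z m = w m) with hLw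
  have hLne : Lw.Nonempty := ⟨w, Finset.mem_filter.2 ⟨(hmemCf w).2 hwC, fun m _ => rfl⟩⟩
  obtain ⟨t, ht, htmax⟩ := Finset.exists_max_image Lw (fun z => z j) hLne
  have htC : t ∈ C := (hmemCf t).1 (Finset.mem_filter.1 ht).1
  have htw : ∀ m, m ≠ j → t m = w m := (Finset.mem_filter.1 ht).2
  have ht_out : t + Pi.single j 1 ∉ C := fun h => by
    have hmem : t + Pi.single j 1 ∈ Lw := by
      refine Finset.mem_filter.2 ⟨(hmemCf _).2 h, fun m hm => ?_⟩
      rw [add_single_apply_ne t hm, htw m hm]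
    have := htmax _ hmem
    rw [add_single_apply_self] at this
    linarith
  have ht_ne_xt : t ≠ xt j := fun h => hw (by rw [← htw i₀ hj.symm, h])
  -- the family of `2d + 1` closed edges of `K_n`
  let f : Option (Fin d × Bool) → Sym2 (Site d) := fun a =>
    match a with
    | none => s(t, t + Pi.single j 1)
    | some (i, true) => s(xt i, xt i + Pi.single i 1)
    | some (i, false) => s(xb i - Pi.single i 1, (xb i - Pi.single i 1) + Pi.single i 1)
  have hfmem : ∀ a, f a ∈ edgesTouching (zdGraph d) (box d n) \ S := by
    rintro (_ | ⟨i, _ | _⟩)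
    · exact mem_sdiff_of_boundary hS hSn ⟨fun _ => ht_out, fun _ => htC⟩
    · refine mem_sdiff_of_boundary hS hSn ⟨fun h => absurd h (hxb_out i), fun h => ?_⟩
      exact absurd (by rw [sub_add_cancel]; exact hxbC i) h
    · exact mem_sdiff_of_boundary hS hSn ⟨fun _ => hxt_out i, fun _ => hxtC i⟩
  have hinj : Function.Injective f := by
    rintro (_ | ⟨i, _ | _⟩) (_ | ⟨i', _ | _⟩) hab
    · rfl
    · obtain ⟨hij, hxy⟩ := eq_of_edge_eq hab
      subst hij
      have h1 := hxbmin j t htC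
      rw [hxy, sub_single_apply_self] at h1
      linarith
    · obtain ⟨hij, hxy⟩ := eq_of_edge_eq hab
      subst hij
      exact absurd hxy ht_ne_xt
    · obtain ⟨hij, hxy⟩ := eq_of_edge_eq hab
      subst hij
      have h1 := hxbmin i t htC
      rw [← hxy, sub_single_apply_self] at h1
      linarith
    · obtain ⟨hij, _⟩ := eq_of_edge_eq hab
      subst hij
      rfl
    · obtain ⟨hij, hxy⟩ := eq_of_edge_eq hab
      subst hij
      exfalso
      have h1 : xt i = xb i - Pi.single i 1 := hxy.symm
      have : xt i + Pi.single i 1 ∈ C := by rw [h1, sub_add_cancel]; exact hxbC i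
      exact hxt_out i this
    · obtain ⟨hij, hxy⟩ := eq_of_edge_eq hab
      subst hij
      exact absurd hxy.symm ht_ne_xt
    · obtain ⟨hij, hxy⟩ := eq_of_edge_eq hab
      subst hij
      exfalso
      have : xt i + Pi.single i 1 ∈ C := by rw [hxy, sub_add_cancel]; exact hxbC i
      exact hxt_out i this
    · obtain ⟨hij, _⟩ := eq_of_edge_eq hab
      subst hij
      rfl
  calc 2 * d + 1 = (Finset.univ : Finset (Option (Fin d × Bool))).card := by
        rw [Finset.card_univ, Fintype.card_option, Fintype.card_prod, Fintype.card_fin, Fintype.card_bool, Nat.mul_comm]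
    _ = ((Finset.univ : Finset (Option (Fin d × Bool))).image f).card :=
        (Finset.card_image_of_injective _ hinj).symm
    _ ≤ (edgesTouching (zdGraph d) (box d n) \ S).card :=
        Finset.card_le_card (Finset.image_subset_iff.2 fun a _ => hfmem a)

/-! ### §3. The case `n = 1`: the `2d` origin edges -/

/-- There are `2d` origin edges `s(0, u)`, `u ∼ 0`. -/
theorem card_originEdges (d : ℕ) : (((zdGraph d).neighborFinset 0).image fun u : Site d => s((0 : Site d), u)).card = 2 * d := by
  rw [Finset.card_image_of_injective _ fun u v h => Sym2.congr_right.1 h]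
  exact card_neighborFinset_zdGraph_holds (0 : Site d)

/-- Membership in the set of origin edges. -/
theorem mem_originEdges {e : Sym2 (Site d)} :
    e ∈ (((zdGraph d).neighborFinset 0).image fun u : Site d => s((0 : Site d), u)) ↔ ∃ u, (zdGraph d).Adj 0 u ∧ e = s(0, u) := by
  simp only [Finset.mem_image, SimpleGraph.mem_neighborFinset]
  exact ⟨fun ⟨u, hu, h⟩ => ⟨u, hu, h.symm⟩, fun ⟨u, hu, h⟩ => ⟨u, hu, h.symm⟩⟩

/-- The origin edges touch `Λ_n` (every `n`). -/
theorem originEdges_subset (n : ℕ) : (((zdGraph d).neighborFinset 0).image fun u : Site d => s((0 : Site d), u)) ⊆ edgesTouching (zdGraph d) (box d n) := by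
  intro e he
  obtain ⟨u, hu, rfl⟩ := mem_originEdges.1 he
  rw [mem_edgesTouching_iff]
  exact ⟨(SimpleGraph.mem_edgeSet _).2 hu, 0, zero_mem_box d n, Sym2.mem_mk_left _ _⟩

/-- **`|C| = 1` iff no origin edge is open** (configuration `↑S ∩ E`). -/
theorem ncard_eq_one_iff (S : Finset (Sym2 (Site d))) :
    ((openCluster ((↑S : Set (Sym2 (Site d))) ∩ (zdGraph d).edgeSet) 0).Finite ∧
      (openCluster ((↑S : Set (Sym2 (Site d))) ∩ (zdGraph d).edgeSet) 0).ncard = 1) ↔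
    ∀ e ∈ (((zdGraph d).neighborFinset 0).image fun u : Site d => s((0 : Site d), u)), e ∉ S := by
  constructor
  · rintro ⟨hfin, h1⟩ e he heS
    obtain ⟨u, hu, rfl⟩ := mem_originEdges.1 he
    have huC : u ∈ openCluster ((↑S : Set (Sym2 (Site d))) ∩ (zdGraph d).edgeSet) 0 :=
      mem_openCluster_of_mem (mem_openCluster_self _ 0) ⟨Finset.mem_coe.2 heS, (SimpleGraph.mem_edgeSet _).2 hu⟩ hu.ne
    have hlt : 1 < (openCluster ((↑S : Set (Sym2 (Site d))) ∩ (zdGraph d).edgeSet) 0).ncard :=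
      (Set.one_lt_ncard hfin).2 ⟨0, mem_openCluster_self _ 0, u, huC, hu.ne⟩
    omega
  · intro h
    have hC : openCluster ((↑S : Set (Sym2 (Site d))) ∩ (zdGraph d).edgeSet) 0 = {(0 : Site d)} := by
      refine Set.eq_singleton_iff_unique_mem.2 ⟨mem_openCluster_self _ 0, fun y hy => ?_⟩
      obtain ⟨p⟩ := (hy : (openGraph ((↑S : Set (Sym2 (Site d))) ∩ (zdGraph d).edgeSet)).Reachable 0 y)
      cases p with
      | nil => rfl
      | cons hadj p' =>
        exfalso
        rename_i w
        obtain ⟨⟨hwS, hwE⟩, hne⟩ := (openGraph_adj _ _ _).1 hadj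
        refine h _ (mem_originEdges.2 ⟨w, (SimpleGraph.mem_edgeSet _).1 hwE, rfl⟩) (Finset.mem_coe.1 hwS)
    rw [hC]
    exact ⟨Set.finite_singleton _, Set.ncard_singleton _⟩

/-- For `|C| = 1` the origin edges are closed edges of `K_n`: they lie in `K_n ∖ S`, hence `2d ≤ #(K_n ∖ S)`. -/
theorem originEdges_subset_sdiff {S : Finset (Sym2 (Site d))} (h : ∀ e ∈ (((zdGraph d).neighborFinset 0).image fun u : Site d => s((0 : Site d), u)), e ∉ S) (n : ℕ) :
    (((zdGraph d).neighborFinset 0).image fun u : Site d => s((0 : Site d), u)) ⊆ edgesTouching (zdGraph d) (box d n) \ S := fun e he =>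
  Finset.mem_sdiff.2 ⟨originEdges_subset n he, h e he⟩

/-! ### §4. The case `n = 0` is void -/

/-- `|C| = 0` with `C` finite is impossible (`0 ∈ C`). -/
theorem not_ncard_eq_zero (ω : BondConfig (Site d)) :
    ¬ ((openCluster ω 0).Finite ∧ (openCluster ω 0).ncard = 0) := by
  rintro ⟨hfin, h0⟩
  have hempty := (Set.ncard_eq_zero hfin).1 h0
  have h := mem_openCluster_self ω (0 : Site d)
  rw [hempty] at h
  exact h

end ThetaGerm

end Summit.CriticalPhenomena.PercolationContinuityZ3.Theorems

end
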